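import Summits.ResolutionOfSingularities.ResolutionOfSingularities.Theorems.FrobeniusLadderFInjectiveMacaulayficationFTemkinClosedPointsLocal
import Summits.ResolutionOfSingularities.ResolutionOfSingularities.Theorems.FrobeniusLadderFInjectiveMacaulayficationLocalFullificationFibreClosedGe4
import Summits.ResolutionOfSingularities.ResolutionOfSingularities.Theorems.FrobeniusLadderFInjectiveMacaulayficationRegularOffFiniteOfLR
import Summits.ResolutionOfSingularities.ResolutionOfSingularities.Theorems.FrobeniusLadderFInjectiveMacaulayficationRegularOffFiniteOfLRFibre
import HarnessLib

/-!
# A FULL blow-up model of every variety of dimension ≥ 4 from the TWO LOCAL statements of door v36 «LocalDoor» — named wrappers, weakest forms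
# (crux `FInjectiveMacaulayfication` stmt-ResolutionOfSingularities-15315, chain w45a; res-L1-w45a-plan-1 RULINGS R17.4 (E5) / R17.6 (2) «(LR) ↦ (LR♭),
# (LF) ↦ (LF_cl) ride as v36.1 by one-name rebinds»; seat res-L1-w45a-stub-2 g6)

[OURS · L1 W4.5a] Support file (`--supports stmt-ResolutionOfSingularities-15315 --as helper`); replaces the role of NO printed item; NOT a statement
of the manuscript; def-free; THEOREMS modulo `CossartPiltant2019General` (CP 2019 Thm. 1.1 (i)(ii)), `Stacks081R` (Raynaud–Gruson 5.2.2),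
`CossartPiltant2019Principalization` (CP 2019 Prop. 4.4) BY NAME and modulo CANDIDATE local statements of OURS consumed as hypotheses only:
(LR) `RegularOffFiniteOfLR.LocalResolutionNonClosedGe4` / its Temkin-(iii) weakening (LR♭) `RegularOffFiniteOfLRFibre.LocalResolutionNonClosedGe4Fibre`
(res-L1-w45a-stub-3: local RESOLUTION of blow-ups of `Spec 𝒪_{X,x}` at NON-closed `x` of local dimension `≥ 4`), and (LF)
`LocalFullificationFibreGe4.LocalFullificationFibreGe4` / its closed-point weakening (LF_cl) `LocalFullificationFibreClosedGe4.LocalFullificationFibreClosedGe4`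
(this seat: fibre-supported local FULL-ification at [closed] points of local dimension `d ≥ 4`). AI-written (AI review is weaker than expert review).

For an integral separated finite-type `X/k` (`char k = p`) of dimension `≥ 4`: THEOREM A-gen (stub-3's `regularOffFinite_of_LR` / `regularOffFinite_of_LRfibre`:
one blowing up, centre in `Sing X`, regular off finitely many CLOSED points — from (LR)/(LR♭) above local dimension 3 and Cossart–Piltant at local
dimension 3) followed by this seat's dimension-free F-Temkin engine (`FTemkinClosedPointsLocal`, the local FULL-ification consumed at the CLOSED residual
points only) gives a blowing up `X″ → X` along `J″ ≠ ⊥`, `Supp J″ ⊆ Sing X`, FULL (domain ∧ CM-clause ∧ F-clause) AT EVERY POINT.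
* **`exists_isBlowup_full_of_LFclosed_of_LRfibre (hLFcl) (hG h081R hP) (hLR♭) … (hd : 4 ≤ dim X)`** — the WEAKEST pair (what v36.1 registers);
* `exists_isBlowup_full_of_LFfibre (hLF) (hG h081R hP) (hLR) … (hd)` — the (LF) × (LR) form announced for res-L1-w45a-stub-1's (E6) `OfLocalDoor`, a
  one-liner through the comparisons `localFullificationFibreClosedGe4_of_ge4` and stub-3's `localResolutionNonClosedGe4Fibre_of_localResolutionNonClosedGe4`;
* `fiModel_integral_of_localDoor_ge4[_weak]` — the same two, read as the crux's model property (proper birational INTEGRAL model FULL everywhere =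
  RHS of `Reductions.fInjectiveMacaulayfication_iff_integral` for `X` of dimension `≥ 4`).
[folklore assembly; cite: Temkin2008, Prop. 2.3.4 and Lemma 2.1.1] [cite: CossartPiltant2019, Thm. 1.1 (i)(ii); Prop. 4.4] [cite: RaynaudGruson1971, Thm. 5.2.2]
-/

-- single-problem summit: the doubled namespace component is forced
set_option linter.dupNamespace false

noncomputable section

namespace Summit.ResolutionOfSingularities.ResolutionOfSingularities.Theorems.FInjectiveMacaulayfication.FullBlowupOfLocalDoor

open CategoryTheory CategoryTheory.Limits AlgebraicGeometry TopologicalSpace IsLocalRing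
open Literature.AlgebraicGeometry.Resolution
open Summit.ResolutionOfSingularities.ResolutionOfSingularities.Theorems.FInjectiveMacaulayfication
open SliceableCentre

/-- `3 ≤ dim X` from `4 ≤ dim X`. [plumbing] -/
theorem three_le_of_four_le {D : WithBot ℕ∞} (hd : (4 : WithBot ℕ∞) ≤ D) : (3 : WithBot ℕ∞) ≤ D :=
  le_trans (by exact_mod_cast (by norm_num : (3 : ℕ) ≤ 4)) hd

/-! ## §1 The weakest pair: (LF_cl) × (LR♭) -/

/-- **Every integral variety of dimension `≥ 4` has a `Sing X`-supported blow-up model FULL at every point, modulo (LF_cl), (LR♭) and the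
threefold package** — the weakest registered forms. [OURS · conditional-result] [cite: Temkin2008, Prop. 2.3.4 (iii)]
[cite: CossartPiltant2019, Thm. 1.1 (i)(ii); Prop. 4.4] -/
theorem exists_isBlowup_full_of_LFclosed_of_LRfibre
    (hLF : LocalFullificationFibreClosedGe4.LocalFullificationFibreClosedGe4)
    (hG : CossartPiltant2019General.{0}) (h081R : Stacks081R.{0}) (hP : CossartPiltant2019Principalization.{0})
    (hLR : RegularOffFiniteOfLRFibre.LocalResolutionNonClosedGe4Fibre)
    (p : ℕ) (hp : p.Prime) (k : Type) [Field k] [CharP k p] (X : Scheme.{0}) (f₀ : X ⟶ Spec (.of k))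
    [IsSeparated f₀] [LocallyOfFiniteType f₀] [QuasiCompact f₀] [IsIntegral X] (hd : (4 : WithBot ℕ∞) ≤ topologicalKrullDim X) :
    ∃ (X'' : Scheme.{0}) (f'' : X'' ⟶ X) (J'' : X.IdealSheafData), IsBlowup f'' J'' ∧ J'' ≠ ⊥ ∧
      (J''.support : Set X) ⊆ (Scheme.regularLocus X)ᶜ ∧ ∀ x'' : X'', FullCl p (X''.presheaf.stalk x'') :=
  FTemkinClosedPointsLocal.exists_isBlowup_full_of_LFclosed_of_regularOffFinite (fun d hd4 => hLF d hd4) p hp k X f₀ hd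
    (RegularOffFiniteOfLRFibre.regularOffFinite_of_LRfibre hG h081R hP hLR p hp k X f₀ (three_le_of_four_le hd))

/-! ## §2 The (LF) × (LR) form (announced name, consumed by `OfLocalDoor`) -/

/-- **Every integral variety of dimension `≥ 4` has a `Sing X`-supported blow-up model FULL at every point, modulo (LF), (LR) and the threefold
package** (one-liner through the comparisons (LF) ⇒ (LF_cl), (LR) ⇒ (LR♭)). [OURS · conditional-result] [cite: Temkin2008, Prop. 2.3.4]
[cite: CossartPiltant2019, Thm. 1.1 (i)(ii); Prop. 4.4] -/
theorem exists_isBlowup_full_of_LFfibre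
    (hLF : LocalFullificationFibreGe4.LocalFullificationFibreGe4)
    (hG : CossartPiltant2019General.{0}) (h081R : Stacks081R.{0}) (hP : CossartPiltant2019Principalization.{0})
    (hLR : RegularOffFiniteOfLR.LocalResolutionNonClosedGe4)
    (p : ℕ) (hp : p.Prime) (k : Type) [Field k] [CharP k p] (X : Scheme.{0}) (f₀ : X ⟶ Spec (.of k))
    [IsSeparated f₀] [LocallyOfFiniteType f₀] [QuasiCompact f₀] [IsIntegral X] (hd : (4 : WithBot ℕ∞) ≤ topologicalKrullDim X) :
    ∃ (X'' : Scheme.{0}) (f'' : X'' ⟶ X) (J'' : X.IdealSheafData), IsBlowup f'' J'' ∧ J'' ≠ ⊥ ∧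
      (J''.support : Set X) ⊆ (Scheme.regularLocus X)ᶜ ∧ ∀ x'' : X'', FullCl p (X''.presheaf.stalk x'') :=
  exists_isBlowup_full_of_LFclosed_of_LRfibre (LocalFullificationFibreClosedGe4.localFullificationFibreClosedGe4_of_ge4 hLF) hG h081R hP
    (RegularOffFiniteOfLRFibre.localResolutionNonClosedGe4Fibre_of_localResolutionNonClosedGe4 hLR) p hp k X f₀ hd

/-! ## §3 Read as the crux's model property -/

/-- The weakest pair, read as the crux's model property: a proper birational INTEGRAL model FULL at every point, for `X` of dimension `≥ 4`.
[OURS · conditional-result] [cite: Temkin2008, Prop. 2.3.4 (iii)] -/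
theorem fiModel_integral_of_localDoor_ge4_weak
    (hLF : LocalFullificationFibreClosedGe4.LocalFullificationFibreClosedGe4)
    (hG : CossartPiltant2019General.{0}) (h081R : Stacks081R.{0}) (hP : CossartPiltant2019Principalization.{0})
    (hLR : RegularOffFiniteOfLRFibre.LocalResolutionNonClosedGe4Fibre)
    (p : ℕ) [hp : Fact p.Prime] (k : Type) [Field k] [CharP k p] (X : Scheme.{0}) (f₀ : X ⟶ Spec (.of k))
    [IsSeparated f₀] [LocallyOfFiniteType f₀] [QuasiCompact f₀] [IsIntegral X] (hd : (4 : WithBot ℕ∞) ≤ topologicalKrullDim X) :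
    ∃ (X' : Scheme.{0}) (π : X' ⟶ X), IsProper π ∧ IsBirational π ∧ IsIntegral X' ∧ ∀ x : X', FullCl p (X'.presheaf.stalk x) := by
  haveI : IsLocallyNoetherian X := LocallyOfFiniteType.isLocallyNoetherian f₀
  obtain ⟨X'', f'', J'', hf'', hJ'', -, hfull⟩ := exists_isBlowup_full_of_LFclosed_of_LRfibre hLF hG h081R hP hLR p hp.out k X f₀ hd
  haveI : IsIntegral X'' := hf''.isIntegral hJ''
  exact ⟨X'', f'', hf''.isProper, hf''.isBirational' hJ'', inferInstance, hfull⟩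

/-- The (LF) × (LR) form, read as the crux's model property. [OURS · conditional-result] [cite: Temkin2008, Prop. 2.3.4] -/
theorem fiModel_integral_of_localDoor_ge4
    (hLF : LocalFullificationFibreGe4.LocalFullificationFibreGe4)
    (hG : CossartPiltant2019General.{0}) (h081R : Stacks081R.{0}) (hP : CossartPiltant2019Principalization.{0})
    (hLR : RegularOffFiniteOfLR.LocalResolutionNonClosedGe4)
    (p : ℕ) [Fact p.Prime] (k : Type) [Field k] [CharP k p] (X : Scheme.{0}) (f₀ : X ⟶ Spec (.of k))
    [IsSeparated f₀] [LocallyOfFiniteType f₀] [QuasiCompact f₀] [IsIntegral X] (hd : (4 : WithBot ℕ∞) ≤ topologicalKrullDim X) :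
    ∃ (X' : Scheme.{0}) (π : X' ⟶ X), IsProper π ∧ IsBirational π ∧ IsIntegral X' ∧ ∀ x : X', FullCl p (X'.presheaf.stalk x) :=
  fiModel_integral_of_localDoor_ge4_weak (LocalFullificationFibreClosedGe4.localFullificationFibreClosedGe4_of_ge4 hLF) hG h081R hP
    (RegularOffFiniteOfLRFibre.localResolutionNonClosedGe4Fibre_of_localResolutionNonClosedGe4 hLR) p k X f₀ hd

end Summit.ResolutionOfSingularities.ResolutionOfSingularities.Theorems.FInjectiveMacaulayfication.FullBlowupOfLocalDoor

end
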